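import Literature.MathematicalPhysics.QuantumFieldTheory.Balaban1983to89.B7Prop8PrintedConstants
import Literature.MathematicalPhysics.QuantumFieldTheory.Balaban1983to89.B9Eq3114Proof

/-!
# `Balaban1983to89.B8Eq1112Quotient` — T. Bałaban, *Spaces of regular gauge field configurations on a lattice and gauge
fixing conditions*, Commun. Math. Phys. **99** (1985) 75–102 [Balaban1985RegularSpaces], proof of Theorem 4, (1.112) p. 95:
the Proposition-8-of-[3] step «u′ = u₂u₁⁻¹ satisfies (1.73), (1.74) … This follows from Proposition 8 of [3]» — the tacit
INVERSE-CLOSURE of the classes `Λ_k(U₀, α₃)` of [3] = T. Bałaban, *Averaging operations for lattice gauge theories*, Commun.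
Math. Phys. **98** (1985) 17–51 [Balaban1985Averaging], on the concrete `ℤ^d` carriers

statement-level skeleton of published theorems with citation tags; proofs where landed; nothing here is a claim about the Yang–Mills mass gap

PDF held: `paper:balaban1985-cmp99-regular-spaces-gauge-fixing` (journal page = PDF page + 74), render
`…/1985-cmp99-regular-spaces-gauge-fixing-p021-x2.png` (p. 95); `paper:balaban1985-cmp98-averaging` (journal = PDF + 16),
render `…/1985-cmp98-averaging-p029-x2.png` (p. 45) — READ AS IMAGES by this seat.

CITATION HEADER (lean-in-tree rule) / WHAT IS REPRODUCED.  lit-balaban SKELETON rows `B8.Eq1.111` ((1.110)–(1.112) p. 95;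
owner r05) and `B7.Prop8` (Proposition 8 p. 45 of [3]; owner r04).  PRINT, B8 p. 95, verbatim: "Now if u₁, u₂ are two solutions
of the problem described in this theorem, then the configurations U₁ = U₁′^{u₁⁻¹}, U₂ = U₁′^{u₂⁻¹} satisfy the conditions of the
theorem, especially the bounds (1.62). This implies that u′ = u₂u₁⁻¹ satisfies the regularity conditions (1.73), (1.74) with k
instead of k − 1 and with a worse constant. This follows from Proposition 8 of [3]. For α₀ + α₁ sufficiently small the assumptions
of this proposition are satisfied …" (1.112).  PRINT, [3] p. 45: "**Proposition 8.** If u₁, u₂ ∈ Λ_k(U₀, α₃) and α₃ is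
sufficiently small, i.e., α₃ ≦ c₆ for some c₆, then u = u₁u₂ ∈ Λ_k(U₀, 2α₃ + 2C₃α₃²) and we have (173)."

WHY THIS FILE.  Proposition 8 of [3] is stated for the PRODUCT `u₁u₂` of two members of `Λ_k(U₀, α₃)`; B8 p. 95 applies it to the
QUOTIENT `u₂u₁⁻¹`.  The tacit step is that `Λ_k(U₀, α₃)` ((166)–(167) p. 44 of [3]) is closed under `u ↦ u⁻¹` — which holds
EXACTLY (same `α₃`) for `G`-valued (`G ⊂ U(N)`) data, because the twisted averages (78)–(80) of [3] commute with inversion: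
`\overline{R₀(u⁻¹)}ʲ = (\overline{R₀u}ʲ)⁻¹` (the logarithm (21) satisfies `log X⁻¹ = −log X` and is conjugation covariant).  The
B8 skeleton `B8.lean` carries the p. 95 sentence as the hypothesis SHAPE `hP8` of `B8.thm4Unique_of_prop5R`; this file supplies the
kernel fact on the concrete `ℤ^d` carriers of the [3]-formalization (`B7Eq84Concrete.uavg`, `B7Eq167Flat.InLambda`), combining the
inverse-closure with Proposition 8 in the printed constants (`B7Prop8PrintedConstants.prop8_printed`, p248608).

CONTENTS (kernel, no `sorry`; `≤` for print's `<`; `η` free with `L^kη ≤ 1` — print `η = L^{−k}`):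
* §1 `R0fun_inv`, `Sexp_inv`, `savg_inv`, `R0avg_inv` — the one-step twisted site average (78) of [3] of the pointwise inverse is
  the inverse of the average, EXACTLY, whenever the block quantities `v(y)⁻¹(R_{0,y}v)(x)` lie within `½` of `1` (any complete normed
  algebra; `B9Eq3114Proof.mlog_units_inv`, `B7Eq170Flat.mlog_cj`/`exp_cj`).
* §2 `uavg_inv` — (79)–(80) iterated: `\overline{R₀(u⁻¹)}ʲ = (\overline{R₀u}ʲ)⁻¹`, `j ≤ k`, under the (167)-smallness `βL^kη < ½`.
* §3 `inLambda_inv` — for unitary-valued `u` at unitary levels `Ū₀ʲ`: `u ∈ Λ_k(U₀, α₃) ⇒ u⁻¹ ∈ Λ_k(U₀, α₃)` (same constant: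
  `‖AB⁻¹ − 1‖ = ‖A⁻¹B − 1‖`, `‖A⁻¹ − 1‖ = ‖A − 1‖` for unitaries).
* §4 **`eq1112_quotient`** — B8 (1.112): unitary `u₁, u₂ ∈ Λ_k(U₀, α₃)`, `α₃ ≤ 1/3000` ⇒ `u₂u₁⁻¹ ∈ Λ_k(U₀, 2α₃ + 2C₃α₃²)`
  (`C₃ = 1116`), with the factorisation (173) `\overline{R₀(u₂u₁⁻¹)}ʲ = \overline{R₀u₂}ʲ·(\overline{R₀u₁}ʲ)⁻¹·e^{r_j}`,
  `‖r_j‖ ≤ 2C₃(α₃Lʲη)²` (`eq173_quotient`); `eq1112_quotient_of52` for a unitary background with (52).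
READINGS: as `B7Prop8PrintedConstants` (explicit `c₆ = 1/3000`, `L ≥ 2`, `0 ≤ η`, `L^kη ≤ 1`, `ℤ^d` carriers, unitary = print's
`G ⊂ U(N)`).  NOT CLAIMED: the "worse constant" bookkeeping of (1.73)–(1.74) themselves (rows B8.Eq1.72/B8.Eq1.111, `B8Ineq170`),
nor anything of the abstract `B8.lean` skeleton.  Unit `lit-balaban-p05` gen 3 (literature-prover-lit-balaban-p05-g3-0); HOME
`run/shared/lean/pub/lit-balaban/`.
-/

noncomputable section

open NormedSpace Finset

namespace Literature.MathematicalPhysics.QuantumFieldTheory.Balaban1983to89.B8Eq1112Quotient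

open B7Prop1Explicit MatrixLog B7Prop2Explicit B7Eq92Concrete B7Eq99Concrete B7Eq84Concrete B7Eq167Flat B7Eq170Flat
  B7Eq170General B7Prop8Flat B7Prop8General B7Prop8PrintedConstants
open B9Eq3114Proof (mlog_units_inv)

export B7Prop1Explicit (Site)

variable {d : ℕ}

/-! ## §1 The twisted site average (78) of [3] commutes with inversion -/

section General

variable {𝔸 : Type*} [NormedRing 𝔸] [NormedAlgebra ℂ 𝔸] [CompleteSpace 𝔸]

omit [NormedAlgebra ℂ 𝔸] [CompleteSpace 𝔸] in
/-- The rotation (display after (59), p. 27 of [3]) of the pointwise inverse: `(R_{0,y}v⁻¹)(x) = ((R_{0,y}v)(x))⁻¹` —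
`R(W)` is a group automorphism ((57) of [3]). [cite: Balaban1985Averaging, (56)–(57) p.27] -/
theorem R0fun_inv (V₀ : Site d → Fin d → 𝔸ˣ) (y : Site d) (v : Site d → 𝔸ˣ) :
    R0fun V₀ y v⁻¹ = (R0fun V₀ y v)⁻¹ := by
  funext x
  simp only [R0fun_apply, Pi.inv_apply, map_inv]

/-- The exponent of (78) for the inverse function: `S_{g⁻¹}(y) = R(g(y))[−S_g(y)]`, because `g(y)(g(x))⁻¹ =
R(g(y))[(g(y)⁻¹g(x))⁻¹]`, the logarithm (21) is conjugation covariant and `log X⁻¹ = −log X` for `‖X − 1‖ < ½`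
(`B9Eq3114Proof.mlog_units_inv`). [cite: Balaban1985Averaging, (78) p.30, (21) p.21] -/
theorem Sexp_inv (L : ℕ) {g : Site d → 𝔸ˣ} {y : Site d}
    (hW : ∀ r : Fin d → Fin L, ‖((((g y)⁻¹ * g (y + boxVec L r) : 𝔸ˣ)) : 𝔸) - 1‖ < 1 / 2) :
    Sexp L g⁻¹ y = cj (g y) (-Sexp L g y) := by
  rw [Sexp_apply, Sexp_apply, cj_neg, cj_sum, ← sum_neg_distrib]
  refine sum_congr rfl fun r _ => ?_
  have hgrp : (g⁻¹ y)⁻¹ * g⁻¹ (y + boxVec L r) = Rc (g y) ((g y)⁻¹ * g (y + boxVec L r))⁻¹ := by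
    simp only [Pi.inv_apply, Rc_apply]; group
  rw [hgrp, val_Rc_eq_cj, mlog_cj, mlog_units_inv (hW r), cj_smul, cj_neg, smul_neg]

/-- **The site average (78) of the inverse is the inverse of the average**: `{g⁻¹(x)}_{x∈B(y)} = ({g(x)}_{x∈B(y)})⁻¹`,
exactly, whenever `‖g(y)⁻¹g(x) − 1‖ < ½` on the block (`g(y)⁻¹·e^{R(g(y))[−S]} = e^{−S}g(y)⁻¹`). [cite: Balaban1985Averaging, (78) p.30] -/
theorem savg_inv (L : ℕ) {g : Site d → 𝔸ˣ} {y : Site d}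
    (hW : ∀ r : Fin d → Fin L, ‖((((g y)⁻¹ * g (y + boxVec L r) : 𝔸ˣ)) : 𝔸) - 1‖ < 1 / 2) :
    savg L g⁻¹ y = (savg L g y)⁻¹ := by
  rw [savg_apply, savg_apply, Sexp_inv L hW, Pi.inv_apply, cj_apply, expUnit_conj, mul_inv_rev, val_inv_expUnit,
    Rc_apply]
  group

/-- **The twisted site average (78) of the inverse is the inverse of the average**: `(R̄₀v⁻¹)(y) = ((R̄₀v)(y))⁻¹`, exactly,
whenever the quantities `v(y)⁻¹(R_{0,y}v)(x)` of (167)/(180) lie within `½` of `1` for `x ∈ B(y)`.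
[cite: Balaban1985Averaging, (78) p.30, (167) p.44] -/
theorem R0avg_inv (L : ℕ) (V₀ : Site d → Fin d → 𝔸ˣ) {v : Site d → 𝔸ˣ} {y : Site d}
    (hW : ∀ r : Fin d → Fin L, ‖((((v y)⁻¹ * R0fun V₀ y v (y + boxVec L r) : 𝔸ˣ)) : 𝔸) - 1‖ < 1 / 2) :
    R0avg L V₀ v⁻¹ y = (R0avg L V₀ v y)⁻¹ := by
  rw [R0avg, R0avg, R0fun_inv]
  refine savg_inv L (g := R0fun V₀ y v) fun r => ?_
  rw [R0fun_self]
  exact hW r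

/-! ## §2 The `k`-th order averages (79)–(80) commute with inversion -/

variable {L : ℕ} {U₀ : Site d → Fin d → 𝔸ˣ} {u : Site d → 𝔸ˣ} {k : ℕ} {β η : ℝ}

/-- **`\overline{R₀(u⁻¹)}ʲ = (\overline{R₀u}ʲ)⁻¹`, `j ≤ k`**, for `u` satisfying (167) with constant `β`, `βL^kη < ½` (so that every
logarithm taken in (80) has its argument within `½` of `1`; print p. 44: "all operations needed to define R̄₀uᵏ are done always in a
case where proper expressions are small"). [cite: Balaban1985Averaging, (79)–(80) p.30, (167) p.44] -/
theorem uavg_inv (h167 : Cond167 L U₀ u k β η) (hL : 1 ≤ L) (hη : 0 ≤ η) (hβ : 0 ≤ β)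
    (hs : β * (L : ℝ) ^ k * η < 1 / 2) : ∀ j ≤ k, uavg L U₀ u⁻¹ j = (uavg L U₀ u j)⁻¹ := by
  have hLr : (1 : ℝ) ≤ L := by exact_mod_cast hL
  intro j
  induction j with
  | zero => intro _; rfl
  | succ j ih =>
    intro hjk
    have hjlt : j < k := Nat.lt_of_succ_le hjk
    funext z
    rw [uavg_succ, ih hjlt.le, Pi.inv_apply, uavg_succ]
    refine R0avg_inv L (avgIter L U₀ j) fun r => ?_
    rw [R0fun_add]
    calc ‖((((uavg L U₀ u j ((L : ℤ) • z))⁻¹ *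
          Rc (hol (avgIter L U₀ j) ((L : ℤ) • z) (treeWord (boxVec L r)))
            (uavg L U₀ u j ((L : ℤ) • z + boxVec L r)) : 𝔸ˣ)) : 𝔸) - 1‖
        ≤ β * (L : ℝ) ^ (j + 1) * η := h167 j hjlt z r
      _ ≤ β * (L : ℝ) ^ k * η :=
        mul_le_mul_of_nonneg_right (mul_le_mul_of_nonneg_left (pow_le_pow_right₀ hLr hjk) hβ) hη
      _ < 1 / 2 := hs

end General

/-! ## §3 `Λ_k(U₀, α₃)` is closed under inversion (unitary = `G`-valued data, same `α₃`) -/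

section Unitary

variable {𝔸 : Type*} [CStarAlgebra 𝔸]

/-- `|A⁻¹ − 1| = |A − 1|` for unitary `A` (`A⁻¹ = A⋆`). [folklore] -/
private theorem norm_inv_sub_one_of_unitary {A : 𝔸ˣ} (hA : A ∈ unitaryUnits 𝔸) :
    ‖((A⁻¹ : 𝔸ˣ) : 𝔸) - 1‖ = ‖(A : 𝔸) - 1‖ := by
  have hstar := (mem_unitaryUnits).1 ((unitaryUnits 𝔸).inv_mem hA)
  have h : ((A⁻¹ : 𝔸ˣ) : 𝔸) - 1 = ((A⁻¹ : 𝔸ˣ) : 𝔸) * (1 - (A : 𝔸)) := by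
    rw [mul_sub, mul_one, Units.inv_mul]
  rw [h, CStarRing.norm_mem_unitary_mul _ hstar, norm_sub_rev]

/-- `|AB⁻¹ − 1| = |A⁻¹B − 1|` for unitaries `A, B` (both equal `|A − B|`). [folklore] -/
private theorem norm_mul_inv_sub_one_eq {A B : 𝔸ˣ} (hA : A ∈ unitaryUnits 𝔸) (hB : B ∈ unitaryUnits 𝔸) :
    ‖(((A * B⁻¹ : 𝔸ˣ)) : 𝔸) - 1‖ = ‖(((A⁻¹ * B : 𝔸ˣ)) : 𝔸) - 1‖ := by
  have h1 : (((A * B⁻¹ : 𝔸ˣ)) : 𝔸) - 1 = ((A : 𝔸) - (B : 𝔸)) * ((B⁻¹ : 𝔸ˣ) : 𝔸) := by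
    rw [Units.val_mul, sub_mul, Units.mul_inv]
  have h2 : (((A⁻¹ * B : 𝔸ˣ)) : 𝔸) - 1 = ((A⁻¹ : 𝔸ˣ) : 𝔸) * ((B : 𝔸) - (A : 𝔸)) := by
    rw [Units.val_mul, mul_sub, Units.inv_mul]
  rw [h1, h2, CStarRing.norm_mul_mem_unitary _ ((mem_unitaryUnits).1 ((unitaryUnits 𝔸).inv_mem hB)),
    CStarRing.norm_mem_unitary_mul _ ((mem_unitaryUnits).1 ((unitaryUnits 𝔸).inv_mem hA)), norm_sub_rev]

variable {L : ℕ} {U₀ : Site d → Fin d → 𝔸ˣ} {u u₁ u₂ : Site d → 𝔸ˣ} {k : ℕ} {α₃ η : ℝ}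

/-- **`Λ_k(U₀, α₃)` is closed under `u ↦ u⁻¹`** (tacit in B8 p. 95 / [3] p. 45): for a unitary-valued `u ∈ Λ_k(U₀, α₃)` at a
background with unitary-valued `Ū₀ʲ` (`j < k`), `L ≥ 1`, `0 ≤ η`, `0 ≤ α₃`, `α₃L^kη ≤ 1/4`, also `u⁻¹ ∈ Λ_k(U₀, α₃)` with the
SAME `α₃`: by `uavg_inv` the averages of `u⁻¹` are the inverses `(ūʲ)⁻¹` (unitary, `B7Prop8PrintedConstants.uavg_mem_unitaryUnits`),
(166) transfers by `|A⁻¹ − 1| = |A − 1|` and (167) by `|ūʲ(y)(R̄ʲ_{0,y}ūʲ(x))⁻¹ − 1| = |ūʲ(y)⁻¹R̄ʲ_{0,y}ūʲ(x) − 1|`.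
[cite: Balaban1985RegularSpaces, (1.112) p.95; Balaban1985Averaging, (166)–(167) p.44] -/
theorem inLambda_inv (hV : ∀ j < k, ∀ (x : Site d) (κ : Fin d), avgIter L U₀ j x κ ∈ unitaryUnits 𝔸)
    (hu : ∀ x, u x ∈ unitaryUnits 𝔸) (h : InLambda L U₀ u k α₃ η)
    (hL : 1 ≤ L) (hη : 0 ≤ η) (hα0 : 0 ≤ α₃) (hs : α₃ * (L : ℝ) ^ k * η ≤ 1 / 4) :
    InLambda L U₀ u⁻¹ k α₃ η := by
  have hinv := uavg_inv h.2 hL hη hα0 (hs.trans_lt (by norm_num))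
  have hun := uavg_mem_unitaryUnits hV hu h.2 hL hη hα0 hs
  refine ⟨fun j hj z => ?_, fun j hj z r => ?_⟩
  · rw [hinv j hj, Pi.inv_apply, norm_inv_sub_one_of_unitary (hun j hj z)]
    exact h.1 j hj z
  · rw [hinv j hj.le]
    simp only [Pi.inv_apply, inv_inv, map_inv]
    rw [norm_mul_inv_sub_one_eq (hun j hj.le _) (Rc_mem_unitaryUnits (hol_mem_of (hV j hj) _ _) (hun j hj.le _))]
    exact h.2 j hj z r

/-- The inverse of a `G`-valued gauge transformation is `G`-valued. [folklore] -/
private theorem inv_mem_unitaryUnits (hu : ∀ x, u x ∈ unitaryUnits 𝔸) : ∀ x, u⁻¹ x ∈ unitaryUnits 𝔸 := fun x => by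
  rw [Pi.inv_apply]; exact (unitaryUnits 𝔸).inv_mem (hu x)

/-! ## §4 B8 (1.112): `u′ = u₂u₁⁻¹ ∈ Λ_k(U₀, 2α₃ + 2C₃α₃²)` by Proposition 8 of [3] -/

/-- **B8 (1.112), the Proposition-8-of-[3] step, kernel form** ("u′ = u₂u₁⁻¹ satisfies the regularity conditions … with a worse
constant. This follows from Proposition 8 of [3]"): for unitary-valued `u₁, u₂ ∈ Λ_k(U₀, α₃)` at a background with unitary-valued
averaged backgrounds `Ū₀ʲ` (`j < k`), `L ≥ 2`, `0 ≤ η`, `L^kη ≤ 1`, `0 ≤ α₃ ≤ 1/3000`: `u₂u₁⁻¹ ∈ Λ_k(U₀, 2α₃ + 2C₃α₃²)` with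
`C₃ = 1116` — Proposition 8 of [3] in the printed constants (`B7Prop8PrintedConstants.prop8_printed`) applied to `u₂` and `u₁⁻¹`
(`inLambda_inv`). [cite: Balaban1985RegularSpaces, (1.112) p.95; Balaban1985Averaging, Proposition 8 p.45] -/
theorem eq1112_quotient (hV : ∀ j < k, ∀ (x : Site d) (κ : Fin d), avgIter L U₀ j x κ ∈ unitaryUnits 𝔸)
    (hu₁ : ∀ x, u₁ x ∈ unitaryUnits 𝔸) (hu₂ : ∀ x, u₂ x ∈ unitaryUnits 𝔸)
    (hL : 2 ≤ L) (hη : 0 ≤ η) (hk : (L : ℝ) ^ k * η ≤ 1) (hα0 : 0 ≤ α₃) (hα : α₃ ≤ 1 / 3000)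
    (h₁ : InLambda L U₀ u₁ k α₃ η) (h₂ : InLambda L U₀ u₂ k α₃ η) :
    InLambda L U₀ (u₂ * u₁⁻¹) k (2 * α₃ + 2 * 1116 * α₃ ^ 2) η := by
  have hL1 : 1 ≤ L := le_trans (by norm_num) hL
  have hs : α₃ * (L : ℝ) ^ k * η ≤ 1 / 4 := by
    rw [mul_assoc]; exact (mul_le_of_le_one_right hα0 hk).trans (hα.trans (by norm_num))
  exact prop8_printed hV hu₂ (inv_mem_unitaryUnits hu₁) hL hη hk hα0 hα h₂ (inLambda_inv hV hu₁ h₁ hL1 hη hα0 hs)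

/-- **(173) for the quotient** — the form in which (1.73)–(1.74) "with k instead of k − 1" are read off for `u′ = u₂u₁⁻¹`:
`\overline{R₀(u₂u₁⁻¹)}ʲ = \overline{R₀u₂}ʲ·(\overline{R₀u₁}ʲ)⁻¹·e^{r_j}`, `‖r_j‖ ≤ 2C₃(α₃Lʲη)²`, `j ≤ k` (`B7Prop8General.eq173_general`
for `u₂, u₁⁻¹` and `uavg_inv`). [cite: Balaban1985RegularSpaces, (1.112) p.95; Balaban1985Averaging, (173) p.45] -/
theorem eq173_quotient (hV : ∀ j < k, ∀ (x : Site d) (κ : Fin d), avgIter L U₀ j x κ ∈ unitaryUnits 𝔸)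
    (hu₁ : ∀ x, u₁ x ∈ unitaryUnits 𝔸) (hL : 2 ≤ L) (hη : 0 ≤ η) (hk : (L : ℝ) ^ k * η ≤ 1) (hα0 : 0 ≤ α₃)
    (hα : α₃ ≤ 1 / 3000) (h₁ : InLambda L U₀ u₁ k α₃ η) (h₂ : InLambda L U₀ u₂ k α₃ η) :
    ∀ j ≤ k, ∃ r : Site d → 𝔸,
      uavg L U₀ (u₂ * u₁⁻¹) j = vprod (uavg L U₀ u₂ j) (uavg L U₀ u₁ j)⁻¹ r ∧
        ∀ z, ‖r z‖ ≤ 2 * 1116 * (α₃ * (L : ℝ) ^ j * η) ^ 2 := by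
  have hL1 : 1 ≤ L := le_trans (by norm_num) hL
  have ht : α₃ * (L : ℝ) ^ k * η ≤ 1 / 3000 := by
    rw [mul_assoc]; exact (mul_le_of_le_one_right hα0 hk).trans hα
  have hVu : ∀ j < k, ∀ (x : Site d) (κ : Fin d), ((avgIter L U₀ j x κ : 𝔸ˣ) : 𝔸) ∈ unitary 𝔸 :=
    fun j hj x κ => (mem_unitaryUnits).1 (hV j hj x κ)
  have hinv := uavg_inv h₁.2 hL1 hη hα0 (ht.trans_lt (by norm_num))
  intro j hj
  obtain ⟨r, hE, hB⟩ := eq173_general hVu hL hη hα0 (hα.trans (by norm_num)) ht h₂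
    (inLambda_inv hV hu₁ h₁ hL1 hη hα0 (ht.trans (by norm_num))) j hj
  exact ⟨r, by rw [hE, hinv j hj], hB⟩

/-- **B8 (1.112) for a UNITARY background with the regularity (52) of [3]** (levels unitary by Proposition 2 of [3],
`B7Prop2Explicit.prop2_unitaryUnits`): `u₂u₁⁻¹ ∈ Λ_k(U₀, 2α₃ + 2C₃α₃²)`, `C₃ = 1116`.
[cite: Balaban1985RegularSpaces, (1.112) p.95; Balaban1985Averaging, Proposition 8 p.45, Proposition 2 (52)–(54) p.26] -/
theorem eq1112_quotient_of52 [Nontrivial 𝔸] (hL : 2 ≤ L) (hη : 0 ≤ η) (hk : (L : ℝ) ^ k * η ≤ 1)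
    (hα0 : 0 ≤ α₃) (hα : α₃ ≤ 1 / 3000)
    (hU : ∀ (x : Site d) (κ : Fin d), U₀ x κ ∈ unitaryUnits 𝔸)
    (hu₁ : ∀ x, u₁ x ∈ unitaryUnits 𝔸) (hu₂ : ∀ x, u₂ x ∈ unitaryUnits 𝔸)
    {α₀ : ℝ} (hα₀ : 0 < α₀) (hα₀3 : C0 d * α₀ ≤ 1 / 3) (hα₀2 : 2 * α₀ ≤ c2' d L)
    (h52 : pdev U₀ < α₀ * (((L : ℝ) ^ k)⁻¹) ^ 2)
    (h₁ : InLambda L U₀ u₁ k α₃ η) (h₂ : InLambda L U₀ u₂ k α₃ η) :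
    InLambda L U₀ (u₂ * u₁⁻¹) k (2 * α₃ + 2 * 1116 * α₃ ^ 2) η := by
  have hmem := (prop2_unitaryUnits (d := d) L hL k U₀ hU hα₀ hα₀3 hα₀2 h52).2
  exact eq1112_quotient (fun j hj x κ => hmem j hj.le x κ) hu₁ hu₂ hL hη hk hα0 hα h₁ h₂

end Unitary

end Literature.MathematicalPhysics.QuantumFieldTheory.Balaban1983to89.B8Eq1112Quotient

end
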